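import Summits.QuantumFields.YangMills.Theorems.IR.AfPincerUcSharpOnset

/-!
# Line `af-pincer` — slot `af-pincer-Uc`, STUB RESHAPE «sharp merge I♯_SC» (owner REGISTRY WRITE #8, ruling R104, 2026-08-27)

WHY (trigger of record, owner R96 (a): «cplan sharp merge `OnsetSharpUKPcSC` — registrable once `Theorems/IR/AfPincerUcSharpOnset.lean`
lands by name»): that helper module LANDED (tree sha16 6e09b783f2453733; source = crux-plan desk `ym-cplan-19354-af-pincer` split-R99 core,
filed by lane (1)B `ym-19354-onsetsc-p2` per owner filing map R99 (ii)).  It types **I♯_SC** `AfPincerUc.SharpOnset.OnsetSharpUKPcSC`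
(owner R95's target: on the simply connected family, for every `(G, r)` and positive unit map `a → 0` with `LowerBounds G r a`, SOME admissible
`(n, ε)` such that for every rarity budget `δ > 0` the typical format `TypShellCondUKPc` holds for all large `β` at SOME mesh `b ≥ 1` with
`a β · b < T`), the residual `AfPincerUc.SharpOnset.IRNSC` (= the previously registered `stub_irNSC` type VERBATIM, now a tree constant), and
PROVES `ir_of_onsetSharpSC : OnsetSharpUKPcSC → IRNSC → Theses.BalabanLadder.IR` with the criterion stub E discharged BY NAME
(`AfPincerUc.stub_typCriterionUc`, p524017) and `onsetSharpSC_of_onsetSC_af : OnsetMixingTypicalUKPcSC → AFToOnsetUKPc → OnsetSharpUKPcSC`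
(the previously registered pair I_SC ∧ X^{Uc} IMPLIES I♯_SC).

WHAT CHANGES IN THE REGISTRY (single slot of record for crux `IR`, stmt-QuantumFields-19354):
* `stub_typCriterionUc : AfPincerUc.TypCriterionUKPc` — kept, CLOSED BY NAME (p524017), restated here as a one-line citation;
* `stub_onsetSharpSC : AfPincerUc.SharpOnset.OnsetSharpUKPcSC` — NEW, the ONE load-bearing open stub on the simply connected family
  (REPLACES the pair `stub_onsetUcSC : OnsetFormatsUc.OnsetMixingTypicalUKPcSC` + `stub_afOnsetUc : AfPincerUc.AFToOnsetUKPc`, which become a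
  documented SUPPLIER ROUTE: any proof of the pair closes this stub through `onsetSharpSC_of_onsetSC_af`; lane (1)A's AF-window compositions
  (`Theorems/IR/AfPincerUcXCov{,Compact,Pincer}`) and lane (1)B's hereditary activity supplier (`ir_of_activitySupplierHereditarySharpSC`, (6d))
  are the other two documented supplier routes);
* `stub_irNSC : AfPincerUc.SharpOnset.IRNSC` — the RESIDUAL on the non-simply-connected family, same statement as before (now BY NAME; `Iff.rfl`
  with the verbatim ∀-form), UNSTAFFED by ruling R101 (a (T𝒜)-conditional target; idea assets `centre-cover-pullback`, `nsc-revelation-engine-weak-gkr`).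
* composition `IR_of_sharp := AfPincerUc.SharpOnset.ir_of_onsetSharpSC stub_onsetSharpSC stub_irNSC` ⊢ `Theses.BalabanLadder.IR` BY NAME.

WHY I♯_SC AND NOT THE PAIR: I♯_SC is logically WEAKER than I_SC ∧ X^{Uc} (proved implication above) and is exactly what the cone exit consumes
(`irCal_of_sharpUcSC`); the supplier chooses `(n, ε)` and the mesh relative to `a(β)`, so the K-SM∞ hook of record (p528589
`not_afToOnsetUKPc_of_ksmInf`, which bites X^{Uc}) does NOT bite I♯_SC — only late onset at EVERY admissible `(n, ε)` does
(`not_onsetSharpUKPcSC_of_lateOnsetAt`, §5 of the helper module); the universal ∕ δ-uniform twins stay exposed to `OnsetWire.UniformWire`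
(`not_univOnsetSharpSC_of_uniformWire`, `not_deltaUniformOnsetSharpSC_of_uniformWire`) and the Hom-twin lint of R102 (p529536∕p530676) stands:
a proof of `stub_onsetSharpSC` must use structure of faithful `r` beyond the Hom-twin.

PREVIOUS SLOT (superseded in the registry, kept in the tree as history): `Cruxes/IR/Lines/af_pincer_Uc.lean` sha16 d9d9d710e4ae01bd
(commit 4f82918a1f7e; stubs `stub_typCriterionUc` ✓, `stub_onsetUcSC`, `stub_afOnsetUc`, `stub_irNSC`; composition `IR_of_stubsUcSC`).

HONEST FRAMING: a by-name re-key of the skeleton of ONE binder (`IR`) of a CONDITIONAL chain (Track A 0∕28 above `UV`); I♯_SC and the residual are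
OPEN; nothing here proves weak-coupling mixing or a gap; not Clay.  Sorries ONLY inside the two open stubs.
-/

namespace Summit.QuantumFields.YangMills.Cruxes.IR.AfPincerUcSharp

open Summit.QuantumFields.YangMills.Cruxes.IR

/-- stub **E** (typicality criterion, format Uc) — CLOSED BY NAME: `AfPincerUc.stub_typCriterionUc` (p524017, LEAD ym-lead-19354-af-pincer g0). -/
theorem stub_typCriterionUc : AfPincerUc.TypCriterionUKPc :=
  AfPincerUc.stub_typCriterionUc

/-- stub **I♯_SC** (rank: the load-bearing open stub) — sharp typical mixing onset below the physical scale on the SIMPLY CONNECTED family,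
`AfPincerUc.SharpOnset.OnsetSharpUKPcSC`.  Supplier routes (documented, none registered): the pair I_SC ∧ X^{Uc} via
`AfPincerUc.SharpOnset.onsetSharpSC_of_onsetSC_af`; lane (1)A AF-window compositions; lane (1)B hereditary activity supplier (6d).
Why it might fail: late onset at every admissible `(n, ε)` for one `(G, r, a)` (`not_onsetSharpUKPcSC_of_lateOnsetAt`); a proof blind to
faithfulness proves the Hom-twin, refuted modulo `MonopoleWire` (R102). -/
theorem stub_onsetSharpSC : AfPincerUc.SharpOnset.OnsetSharpUKPcSC := by
  sorry

/-- stub **R_NSC** (RESIDUAL, unstaffed by owner ruling R101) — the crux's clause on the NON-simply-connected family,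
`AfPincerUc.SharpOnset.IRNSC` (the previously registered `stub_irNSC` statement verbatim, now by name).  Conditional target of record:
certideate-1's (T𝒜) GOOD-relativised pincer (`irNSC_of_goodPincer`, HOME sketch c5c8a26179c90e05); assets `centre-cover-pullback`,
`nsc-revelation-engine-weak-gkr`.  Why it might fail: format Uc itself is wrong for `π₁ ≠ 1` (`not_onsetMixingTypicalUKPc_of_monopoleWire`). -/
theorem stub_irNSC : AfPincerUc.SharpOnset.IRNSC := by
  sorry

/-- **Composition (kernel-checked, no sorry outside the stubs):** E ∧ I♯_SC ∧ R_NSC ⇒ crux `IR` BY NAME, through the landed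
`AfPincerUc.SharpOnset.irCal_of_sharpUcSC` (all three registered stubs consumed; E is the closed one). -/
theorem IR_of_sharp : Summit.QuantumFields.YangMills.Theses.BalabanLadder.IR := by
  have hI : AfPincerUc.IRCal :=
    AfPincerUc.SharpOnset.irCal_of_sharpUcSC stub_typCriterionUc stub_onsetSharpSC stub_irNSC
  delta Summit.QuantumFields.YangMills.Theses.BalabanLadder.IR
  delta Summit.QuantumFields.YangMills.Cruxes.IR.AfPincerUc.IRCal at hI
  exact hI

end Summit.QuantumFields.YangMills.Cruxes.IR.AfPincerUcSharp
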